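import Summits.BirchSwinnertonDyer.Rank1Residual.PrintCfram.LocalThreeTorsionZpThree
import Summits.BirchSwinnertonDyer.Rank1Residual.X12.O11.RamifiedEllipticUnitMechanismZpThreeGr
import HarnessLib

/-!
# Route `PrintCFram`: regime T `LocalThreeTorsionBSDThree` (item stmt-BirchSwinnertonDyer-20699), V, N and
# the whole `@3` crux C1 `CMRamifiedThreeBSD` (stmt-…-20371) BY NAME from the DEFECT-COMPLETE `ℤ₃`-level
# pair (IMC)₃♮ ∧ (PR|IMC)₃♮ («zpthree-♮»), and the PROVED relation of that pair to gen 1's regime-N pair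
# (items 21352/21353 are its `t_cs = 0` case) (cell `bsd-print-cfram`, D-0131 (2) print tier, seat ty2
# gen 4 = the cell's discharge-interface typer; answer to p2's PRE-SWAP CHECK r6, 2026-08-27T21:19:59Z)

HONEST FRAMING (cell `bsd-print-cfram`, HOME `run/shared/lean/pub/bsd-print-cfram/`): THEOREMS ONLY
(no definition, no named fact, no axiom, no `sorry`); nothing about BSD is booked; regimes N, V, T, the
crux C1 and the leaf `Summit.BirchSwinnertonDyer.WAllCornerFRamifiedAtThree` stay OPEN; 0 cells move;
beyond-print theorem: NO. (`Theorems/` is prover-only for a literature-prover seat, hence this folder.)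

CONTENT (class-wide hypotheses, all UNFOLDED — no route item body is named, D5.1-safe):
* `hfin : ∀ W, X12.O11.LocalKernelFiniteAtThree W` — the local-kernel finiteness obligation (p3's);
* `h1 : ∀ W, HasCM → CMRamified W 3 → r_an = 1 → X12.O11.RamifiedCMEllipticUnitIMCAtZpThreeGr W` and
  `h2 : GZK → ∀ W, … → X12.O11.RamifiedCMBottomClassIndexLawAtZpThreeGr W` (the ♮ pair of companion
  `X12/O11/RamifiedEllipticUnitMechanismZpThreeGr.lean`: bottom dictionary with `τ(T₀)` and `t_cs`).
Then, BY NAME: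
* §1 `indexLawAtThreeT_of_imcGr_of_indexLawGr` (the class-wide (R-EU)₃ᵀ law),
  `localThreeTorsionBSDThree_of_imcGr_of_indexLawGr` : **T**, `splitPlaceTorsionBSDThree_of_imcGr_of_indexLawGr`
  : **V**, `torsionFreeFrameBSDThree_of_imcGr_of_indexLawGr` : **N**,
  `cmRamifiedThreeBSD_of_imcGr_of_indexLawGr_of_localKernelFinite` : **C1** («zpthree-♮»: C1 ⟸ 2
  conjecture-defs ∧ 1 provable finiteness statement) — through ty2 gen 3's edges from (R-EU)₃ᵀ (p571282).
* §2 the relation to gen 1 (p548597): on frames with the `ℚ₃`-binders (A𝔭)₃ (`d₀ = d(∅) = τ(∅) = 1`,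
  `ker r_𝔭 = 0`) and on curves with `t_cs = 0` (no inert place of Kodaira type IV / IV*), (IMC)₃♮ ⟹
  (IMC)₃ᴺ and (PR|IMC)₃♮ ⟹ (PR|IMC)₃ᴺ — so route items 21353 / 21352 are the `t_cs = 0` case of the ♮
  pair; on the curves with `t_cs ≥ 1` (cell census kit j291137: 17 of the 45 regime-N window classes) the
  two pairs differ by `∓ t_cs`. The `_frame` forms (gen 5) carry `t_cs = 0` for the FRAME field `ℚ(√−3)`
  only (per-class dischargeable by ty3 PART I `padicValNat_inertTamagawaProductThree_eq_of_isFrameThree`);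
  gen 4's forms with `t_cs = 0` over ALL `K` (= no IV/IV* place away from `3` at all) are their corollaries.
Nothing is asserted about (IMC)₃♮ / (PR|IMC)₃♮ (CONSTRUCTION / OPEN: not in print at `3`).

References: route file `Theses/PrintCFram.lean` rev ≥ 14 (items 20698, 20699, 20700, 20371, 21352, 21353);
`X12/O11/RamifiedEllipticUnitMechanismZpThree{,V,T,Gr}.lean`, `PrintCfram/LocalThreeTorsionZpThree.lean`
(p571282), `PrintCfram/SplitPlaceTorsionThree.lean` (p554137), `PrintCfram/RegimeSplitThree.lean` (p547523);
[cite: PollackWeston2011, §3.2 Def. 3.3 and Lemma 3.4, §3.3 Prop. 3.7 (shape only)]; [cite: Miller2011LMS, §1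
and Def. 1.1 (arXiv:1010.2431 p. 3) (`BSDp`)]; [cite: GreenbergLNM1716, §3 Lemmas 3.1–3.4 and §4 Prop. 4.13];
[cite: Kolyvagin1990, Thm. A]; [cite: PerrinRiou1993AIF, §3.3.4–3.3.5].
-/

noncomputable section

open scoped Classical

open WeierstrassCurve NumberField IsDedekindDomain Field PowerSeries
  Literature.NumberTheory.EllipticCurves
  Literature.NumberTheory.EllipticCurves.GreenbergSelmer
  Literature.NumberTheory.EllipticCurves.Rank1Residual
  Literature.NumberTheory.EllipticCurves.Rank1Residual.Typed
  Literature.NumberTheory.EllipticCurves.BurungaleKobayashiNakamuraOta2026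
  Literature.NumberTheory.GaloisRepresentations
  Summit.BirchSwinnertonDyer.Rank1Residual
  Summit.BirchSwinnertonDyer.Rank1Residual.Additive
  Summit.BirchSwinnertonDyer.Rank1Residual.X11b
  Summit.BirchSwinnertonDyer.Rank1Residual.X11b.AcSelmer
  Summit.BirchSwinnertonDyer.Rank1Residual.X12.O11
  Summit.BirchSwinnertonDyer.BirchSwinnertonDyer.Theorems
  Summit.BirchSwinnertonDyer.BirchSwinnertonDyer.Theses.PrintCFram

namespace Summit.BirchSwinnertonDyer.Rank1Residual.PrintCfram

/-! ## §1 T, V, N and C1 BY NAME from the class-wide ♮ pair -/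

section Edges

/-- **The class-wide (R-EU)₃ᵀ law from the class-wide ♮ pair, granted GZK** (companion Gr's
`forall_indexAtThreeT_of_forall_imcGr_of_forall_indexLawGr`, re-exported in this namespace).
[cite: Miller2011LMS, Def. 1.1] -/
theorem indexLawAtThreeT_of_imcGr_of_indexLawGr
    (h1 : ∀ (W : WeierstrassCurve ℚ) [W.IsElliptic] [W.IsGloballyMinimal],
      W.HasCM → CMRamified W 3 → W.analyticRank = 1 → RamifiedCMEllipticUnitIMCAtZpThreeGr W)
    (h2 : rank_eq_analyticRank_of_analyticRank_le_one →
      ∀ (W : WeierstrassCurve ℚ) [W.IsElliptic] [W.IsGloballyMinimal],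
      W.HasCM → CMRamified W 3 → W.analyticRank = 1 → RamifiedCMBottomClassIndexLawAtZpThreeGr W)
    (hGZK : rank_eq_analyticRank_of_analyticRank_le_one) :
    ∀ (W : WeierstrassCurve ℚ) [W.IsElliptic] [W.IsGloballyMinimal],
      W.HasCM → W.analyticRank = 1 → CMRamified W 3 → RamifiedCMEllipticUnitIndexAtThreeT W :=
  forall_indexAtThreeT_of_forall_imcGr_of_forall_indexLawGr h1 h2 hGZK

/-- **T (item 20699) BY NAME from the ♮ pair + the local-kernel finiteness obligation** (through ty2
gen 3's `localThreeTorsionBSDThree_of_indexLawAtThreeT`). [cite: Miller2011LMS, Def. 1.1] [cite: Kolyvagin1990, Thm. A] -/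
theorem localThreeTorsionBSDThree_of_imcGr_of_indexLawGr
    (hfin : ∀ (W : WeierstrassCurve ℚ) [W.IsElliptic], LocalKernelFiniteAtThree W)
    (h1 : ∀ (W : WeierstrassCurve ℚ) [W.IsElliptic] [W.IsGloballyMinimal],
      W.HasCM → CMRamified W 3 → W.analyticRank = 1 → RamifiedCMEllipticUnitIMCAtZpThreeGr W)
    (h2 : rank_eq_analyticRank_of_analyticRank_le_one →
      ∀ (W : WeierstrassCurve ℚ) [W.IsElliptic] [W.IsGloballyMinimal],
      W.HasCM → CMRamified W 3 → W.analyticRank = 1 → RamifiedCMBottomClassIndexLawAtZpThreeGr W) :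
    Summit.BirchSwinnertonDyer.BirchSwinnertonDyer.Theses.PrintCFram.LocalThreeTorsionBSDThree :=
  fun hmod hGZ hGZK hCassels =>
    localThreeTorsionBSDThree_of_indexLawAtThreeT hfin (indexLawAtThreeT_of_imcGr_of_indexLawGr h1 h2 hGZK)
      hmod hGZ hGZK hCassels

/-- **V (item 20700) BY NAME from the ♮ pair** (through `splitPlaceTorsionBSDThree_of_indexLawAtThreeT`).
[cite: Miller2011LMS, Def. 1.1] [cite: Kolyvagin1990, Thm. A] -/
theorem splitPlaceTorsionBSDThree_of_imcGr_of_indexLawGr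
    (h1 : ∀ (W : WeierstrassCurve ℚ) [W.IsElliptic] [W.IsGloballyMinimal],
      W.HasCM → CMRamified W 3 → W.analyticRank = 1 → RamifiedCMEllipticUnitIMCAtZpThreeGr W)
    (h2 : rank_eq_analyticRank_of_analyticRank_le_one →
      ∀ (W : WeierstrassCurve ℚ) [W.IsElliptic] [W.IsGloballyMinimal],
      W.HasCM → CMRamified W 3 → W.analyticRank = 1 → RamifiedCMBottomClassIndexLawAtZpThreeGr W) :
    Summit.BirchSwinnertonDyer.BirchSwinnertonDyer.Theses.PrintCFram.SplitPlaceTorsionBSDThree :=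
  fun hmod hGZ hGZK hCassels =>
    splitPlaceTorsionBSDThree_of_indexLawAtThreeT (indexLawAtThreeT_of_imcGr_of_indexLawGr h1 h2 hGZK)
      hmod hGZ hGZK hCassels

/-- **N (item 20698) BY NAME from the ♮ pair** (through `torsionFreeFrameBSDThree_of_indexLawAtThreeT`).
[cite: Miller2011LMS, Def. 1.1] [cite: Kolyvagin1990, Thm. A] -/
theorem torsionFreeFrameBSDThree_of_imcGr_of_indexLawGr
    (h1 : ∀ (W : WeierstrassCurve ℚ) [W.IsElliptic] [W.IsGloballyMinimal],
      W.HasCM → CMRamified W 3 → W.analyticRank = 1 → RamifiedCMEllipticUnitIMCAtZpThreeGr W)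
    (h2 : rank_eq_analyticRank_of_analyticRank_le_one →
      ∀ (W : WeierstrassCurve ℚ) [W.IsElliptic] [W.IsGloballyMinimal],
      W.HasCM → CMRamified W 3 → W.analyticRank = 1 → RamifiedCMBottomClassIndexLawAtZpThreeGr W) :
    Summit.BirchSwinnertonDyer.BirchSwinnertonDyer.Theses.PrintCFram.TorsionFreeFrameBSDThree :=
  fun hmod hGZ hGZK hCassels =>
    torsionFreeFrameBSDThree_of_indexLawAtThreeT (indexLawAtThreeT_of_imcGr_of_indexLawGr h1 h2 hGZK)
      hmod hGZ hGZK hCassels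

/-- **«zpthree-♮»: the whole `@3` crux C1 `CMRamifiedThreeBSD` (item 20371) BY NAME from the ♮ pair +
the local-kernel finiteness obligation**, through the landed glue `cmRamifiedThreeBSDOfRegimes_holds`
(p547523). CONDITIONAL on two conjecture-defs and one provable finiteness statement; nothing booked.
[cite: Miller2011LMS, §1 and Def. 1.1 (arXiv:1010.2431 p. 3)] [cite: Kolyvagin1990, Thm. A] -/
theorem cmRamifiedThreeBSD_of_imcGr_of_indexLawGr_of_localKernelFinite
    (hfin : ∀ (W : WeierstrassCurve ℚ) [W.IsElliptic], LocalKernelFiniteAtThree W)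
    (h1 : ∀ (W : WeierstrassCurve ℚ) [W.IsElliptic] [W.IsGloballyMinimal],
      W.HasCM → CMRamified W 3 → W.analyticRank = 1 → RamifiedCMEllipticUnitIMCAtZpThreeGr W)
    (h2 : rank_eq_analyticRank_of_analyticRank_le_one →
      ∀ (W : WeierstrassCurve ℚ) [W.IsElliptic] [W.IsGloballyMinimal],
      W.HasCM → CMRamified W 3 → W.analyticRank = 1 → RamifiedCMBottomClassIndexLawAtZpThreeGr W) :
    Summit.BirchSwinnertonDyer.BirchSwinnertonDyer.Theses.PrintCFram.CMRamifiedThreeBSD :=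
  cmRamifiedThreeBSDOfRegimes_holds
    (torsionFreeFrameBSDThree_of_imcGr_of_indexLawGr h1 h2)
    (localThreeTorsionBSDThree_of_imcGr_of_indexLawGr hfin h1 h2)
    (splitPlaceTorsionBSDThree_of_imcGr_of_indexLawGr h1 h2)

end Edges

end Summit.BirchSwinnertonDyer.Rank1Residual.PrintCfram

namespace Summit.BirchSwinnertonDyer.Rank1Residual.X12.O11

/-! ## §2 PROVED: on frames with (A𝔭)₃ and `t_cs = 0` the ♮ pair IS the gen-1 regime-N pair -/

section RegimeN

variable {W : WeierstrassCurve ℚ} [W.IsElliptic]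

/-- **(IMC)₃♮ ⟹ (IMC)₃ᴺ on curves with `t_cs = 0` AT THE FRAME** (PROVED; the per-class dischargeable
form, ty3 2026-08-27T22:29:57Z): at a frame carrying the `ℚ₃`-binders (A𝔭)₃ and (Av)₃ everywhere
(p548597's `RamifiedCMEllipticUnitIMCAtZpThree`), `ker r_𝔭 = 0` is finite, `d₀ = 1`
(`globalControlDefectAtThree_eq_one_of_noThreeTorsion`), `d(∅) = 1` (`controlDefectAtThree_empty_eq_one`),
`τ(∅) = 1` (§0); if moreover `t_cs = ord₃ (inertTamagawaProductThree W K) = 0` for the FRAME field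
`K = ℚ(√−3)` (hypothesis `ht`, under the frame binder — per class it is ty3's PART I theorem
`padicValNat_inertTamagawaProductThree_eq_of_isFrameThree` read with `tcsClosedForm k = 0`), the ♮ identity
at `T₀ = ∅` reads «`n₀ + log₃ #X[T] = c`». So route item 21353's body is the `t_cs = 0` case of (IMC)₃♮; on
a curve with an inert place of Kodaira type IV / IV* the two differ by `t_cs`.
[cite: PollackWeston2011, §3.3 Prop. 3.7 (shape only)] [cite: GreenbergLNM1716, §3 Lemmas 3.1 and 3.3–3.4] -/
theorem ramifiedCMEllipticUnitIMCAtZpThree_of_imcGr_of_inertTamagawa_frame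
    (h1 : RamifiedCMEllipticUnitIMCAtZpThreeGr W)
    (ht : ∀ (K : Type) [Field K] [NumberField K] (𝔭 : HeightOneSpectrum (𝓞 K))
      (W' : WeierstrassCurve ℚ) (C : VariableChange ℚ),
      IsFrameThree W K 𝔭 W' C → padicValNat 3 (inertTamagawaProductThree W K) = 0) :
    RamifiedCMEllipticUnitIMCAtZpThree W := by
  intro K _ _ 𝔭 W' _ _ C hF hr κ hκ γ _ htors htors' hv
  haveI : (W.baseChange K).IsElliptic := by rw [baseChange]; infer_instance
  obtain ⟨ι, φ, Ω, 𝓔, D, c, hΩ, hφ, hc, himc⟩ := h1 K 𝔭 W' C hF hr κ hκ γ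
  refine ⟨ι, φ, Ω, 𝓔, D, c, hΩ, hφ, hc, fun n₀ hn₀ hfin => ?_⟩
  have h𝔭 := noThreeTorsion_adicCompletion_of_isFrameThree W hF htors htors'
  have hfin𝔭 : Finite (localKer κ.kerSubgroup ((W.baseChange K).geomPrimaryTorsion 3) 𝔭) := by
    rw [AcSelmer.localKer_eq_bot_of_noPTorsion (W.baseChange K) 3 κ 𝔭 h𝔭]; infer_instance
  have e := himc hfin𝔭 ∅ (fun v hv0 => absurd hv0 (Finset.notMem_empty v))
    (fun v _ h3 he hf => hv v h3 he hf) n₀ hn₀ hfin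
  rw [globalControlDefectAtThree_eq_one_of_noThreeTorsion κ γ h𝔭, controlDefectAtThree_empty_eq_one κ h𝔭,
    localKernelProductAtThree_empty_eq_one W 𝔭 κ h𝔭, ht K 𝔭 W' C hF, padicValNat_one_right, Nat.cast_zero,
    add_zero, add_zero, add_zero, add_zero] at e
  exact e.symm

/-- **(PR|IMC)₃♮ ⟹ (PR|IMC)₃ᴺ on curves with `t_cs = 0` AT THE FRAME** (PROVED; per-class dischargeable
form): at a frame with the (A𝔭)₃ / (Av)₃ binders of p548597's `RamifiedCMBottomClassIndexLawAtZpThree`, take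
`T₀ = ∅`; the pure levels `n, n'` are levels modulo torsion (`modTorsionLevel_of_level_of_noPTorsion`),
`ker r_𝔭 = 0`, `d₀ = d(∅) = τ(∅) = 1`, and with `t_cs = 0` at the frame field the (IMC)₃ᴺ hypothesis
«`n₀ + log₃ #X[T] = c`» is the (IMC)₃♮ hypothesis at `∅`, so the ♮ law specialises to
«`c = n + n' + ord₃ q + ord₃ q'`». Route item 21352's body is thus the `t_cs = 0` case of (PR|IMC)₃♮.
[cite: PerrinRiou1993AIF, §3.3.4–3.3.5] [cite: PollackWeston2011, §3.3 Prop. 3.7 (shape only)] -/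
theorem ramifiedCMBottomClassIndexLawAtZpThree_of_indexLawGr_of_inertTamagawa_frame
    (h2 : RamifiedCMBottomClassIndexLawAtZpThreeGr W)
    (ht : ∀ (K : Type) [Field K] [NumberField K] (𝔭 : HeightOneSpectrum (𝓞 K))
      (W' : WeierstrassCurve ℚ) (C : VariableChange ℚ),
      IsFrameThree W K 𝔭 W' C → padicValNat 3 (inertTamagawaProductThree W K) = 0) :
    RamifiedCMBottomClassIndexLawAtZpThree W := by
  intro K _ _ 𝔭 W' _ _ C hF hr κ hκ γ _ P n P' n' hP hgen htors hdiv hndiv hP' hgen' htors' hdiv' hndiv'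
    hv q q' hq hq' ι φ Ω 𝓔 D c hΩ hφ hc himc
  haveI : (W.baseChange K).IsElliptic := by rw [baseChange]; infer_instance
  have h𝔭 := noThreeTorsion_adicCompletion_of_isFrameThree W hF htors htors'
  have hfin𝔭 : Finite (localKer κ.kerSubgroup ((W.baseChange K).geomPrimaryTorsion 3) 𝔭) := by
    rw [AcSelmer.localKer_eq_bot_of_noPTorsion (W.baseChange K) 3 κ 𝔭 h𝔭]; infer_instance
  obtain ⟨hdivT, hndivT⟩ := modTorsionLevel_of_level_of_noPTorsion 3 htors hdiv hndiv
  obtain ⟨hdivT', hndivT'⟩ := modTorsionLevel_of_level_of_noPTorsion 3 htors' hdiv' hndiv'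
  have hd₀ := globalControlDefectAtThree_eq_one_of_noThreeTorsion (W := W) κ γ h𝔭
  have hd := controlDefectAtThree_empty_eq_one (W := W) κ h𝔭
  have hτ := localKernelProductAtThree_empty_eq_one W 𝔭 κ h𝔭
  have ht0 := ht K 𝔭 W' C hF
  have e := h2 K 𝔭 W' C hF hr κ hκ γ P n P' n' hP hgen hdivT hndivT hP' hgen' hdivT' hndivT' hfin𝔭
    ∅ (fun v hv0 => absurd hv0 (Finset.notMem_empty v)) (fun v _ h3 he hf => hv v h3 he hf)
    q q' hq hq' ι φ Ω 𝓔 D c hΩ hφ hc (fun n₀ hn₀ hfin => by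
      rw [hd₀, hd, hτ, ht0, padicValNat_one_right, Nat.cast_zero, add_zero, add_zero, add_zero, add_zero]
      exact (himc n₀ hn₀ hfin).symm)
  rw [hd₀, hτ, ht0, padicValNat_one_right, Nat.cast_zero, mul_zero, add_zero, add_zero, add_zero] at e
  exact e

/-- **(IMC)₃♮ ⟹ (IMC)₃ᴺ on curves with NO place of Kodaira type IV / IV* away from `3` at all** (PROVED;
the form of gen 4 with `ht` over ALL number fields `K` — a proper sub-case of `t_cs = 0`, since any prime
`ℓ ∤ 3` of type IV/IV* is inert in some quadratic field where `c_w = 3` (ty3 PART I,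
`padicValNat_localTamagawaNumber_baseChange_eq_one_of_IV`); kept by name for its importers; corollary of
the frame-local form). [cite: PollackWeston2011, §3.3 Prop. 3.7 (shape only)]
[cite: GreenbergLNM1716, §3 Lemmas 3.1 and 3.3–3.4] -/
theorem ramifiedCMEllipticUnitIMCAtZpThree_of_imcGr_of_inertTamagawa
    (h1 : RamifiedCMEllipticUnitIMCAtZpThreeGr W)
    (ht : ∀ (K : Type) [Field K] [NumberField K], padicValNat 3 (inertTamagawaProductThree W K) = 0) :
    RamifiedCMEllipticUnitIMCAtZpThree W :=
  ramifiedCMEllipticUnitIMCAtZpThree_of_imcGr_of_inertTamagawa_frame h1 fun K _ _ _ _ _ _ => ht K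

/-- **(PR|IMC)₃♮ ⟹ (PR|IMC)₃ᴺ on curves with NO place of Kodaira type IV / IV* away from `3` at all**
(PROVED; gen 4's ALL-`K` form, corollary of the frame-local form). [cite: PerrinRiou1993AIF, §3.3.4–3.3.5]
[cite: PollackWeston2011, §3.3 Prop. 3.7 (shape only)] -/
theorem ramifiedCMBottomClassIndexLawAtZpThree_of_indexLawGr_of_inertTamagawa
    (h2 : RamifiedCMBottomClassIndexLawAtZpThreeGr W)
    (ht : ∀ (K : Type) [Field K] [NumberField K], padicValNat 3 (inertTamagawaProductThree W K) = 0) :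
    RamifiedCMBottomClassIndexLawAtZpThree W :=
  ramifiedCMBottomClassIndexLawAtZpThree_of_indexLawGr_of_inertTamagawa_frame h2 fun K _ _ _ _ _ _ => ht K

end RegimeN

end Summit.BirchSwinnertonDyer.Rank1Residual.X12.O11

end
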